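import Mathlib
import Summits.NavierStokesRegularity.NavierStokesRegularity.Theorems.EulerZoomLiouvillePowerGaugeEulerLiouvilleNeedleStagnationKinematics

/-!
# Crux `EulerZoomLiouville.PowerGaugeEulerLiouville` (stmt-NavierStokesRegularity-19832), THE ONE STATEMENT `stub_selfSimilarC2Needle`:
# VORTICAL STAGNATION HAS RANK ≥ 2 — at a stagnation point `z` of `W = γy + U` with `Ω(z) ≠ 0` and `γ ≠ 1/2`,
# the range of `DW(z)` is not contained in the vortex line and `dim ker DW(z) ≤ 1`

ROUND-40 (nsreg-p2 g33) §2′ (N4): `DW·Ω = (1+γ)Ω` (plate t40e) and `tr DW = 3γ` forbid a rank-one `DW` at a vortical node unless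
`1 + γ = 3γ`.  Hence for every `ρ > 0` (`γ = 1/(2+ρ) < 1/2`) the vortical stagnation set `{W = 0} ∩ {Ω ≠ 0}` of a `C²` profile is
locally contained in `C²` CURVES (implicit functions), never in surfaces; along such a curve the spectrum of `DW` is exactly
`{1+γ, 0, −ργ}` (trace count, `1 − 2γ = ργ`), so the linearised hovering-volume exponent `ργ` of the waiting room is universal there.

WHAT THIS IS NOT: not NS, not E — kinematics for THE ONE STATEMENT; 19832 is OPEN.  [folklore]
-/

noncomputable section

set_option linter.dupNamespace false

open Set Metric Function InnerProductSpace
open scoped RealInnerProductSpace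

namespace Summit.NavierStokesRegularity.NavierStokesRegularity.Theorems.PowerGaugeEulerLiouville.Stagnation

open Literature.Analysis Literature.Analysis.FluidPDE

variable {γ : ℝ} {U : (EuclideanSpace ℝ (Fin 3)) → (EuclideanSpace ℝ (Fin 3))} {P : (EuclideanSpace ℝ (Fin 3)) → ℝ}

/-! ### Rank of `DW` at a vortical stagnation point -/

/-- Linear algebra: if `T w = μ w` with `w ≠ 0` and the range of `T` lies in the line `ℝ ∙ w`, then `tr T = μ` (`T = ℓ ⊗ w` with `ℓ w = μ`). [folklore] -/
theorem trace_eq_of_range_le_span {T : (EuclideanSpace ℝ (Fin 3)) →ₗ[ℝ] (EuclideanSpace ℝ (Fin 3))} {w : (EuclideanSpace ℝ (Fin 3))} {μ : ℝ} (hw : w ≠ 0) (hT : T w = μ • w)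
    (hrange : ∀ v, T v ∈ ℝ ∙ w) : LinearMap.trace ℝ (EuclideanSpace ℝ (Fin 3)) T = μ := by
  have hw2 : ⟪w, w⟫ ≠ 0 := by
    rw [real_inner_self_eq_norm_sq]; exact pow_ne_zero 2 (norm_ne_zero_iff.2 hw)
  -- the coefficient functional `ℓ v = ⟪T v, w⟫ / ⟪w, w⟫`
  set ℓ : (EuclideanSpace ℝ (Fin 3)) →ₗ[ℝ] ℝ := (⟪w, w⟫)⁻¹ • ((innerSL ℝ w : (EuclideanSpace ℝ (Fin 3)) →L[ℝ] ℝ) : (EuclideanSpace ℝ (Fin 3)) →ₗ[ℝ] ℝ).comp T with hℓ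
  have hℓapp : ∀ v, ℓ v = (⟪w, w⟫)⁻¹ * ⟪w, T v⟫ := fun v => by simp [hℓ]
  have hTeq : T = ℓ.smulRight w := by
    apply LinearMap.ext
    intro v
    obtain ⟨a, ha⟩ := Submodule.mem_span_singleton.1 (hrange v)
    rw [LinearMap.smulRight_apply, hℓapp, ← ha, real_inner_smul_right, ← mul_assoc, mul_right_comm,
      inv_mul_cancel₀ hw2, one_mul]
  have hℓw : ℓ w = μ := by
    rw [hℓapp, hT, real_inner_smul_right, ← mul_assoc, mul_comm ((⟪w, w⟫)⁻¹) μ, mul_assoc, inv_mul_cancel₀ hw2,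
      mul_one]
  rw [hTeq, LinearMap.trace_smulRight, hℓw]

/-- **RANK OF `DW` AT A VORTICAL STAGNATION POINT (`γ ≠ 1/2`): the range of `DW(z)` is NOT contained in the vortex line `ℝ ∙ Ω(z)`.**
Since `DW·Ω = (1+γ)Ω` (t40e) and `tr DW = 3γ`, a range inside `ℝ ∙ Ω` would force `1 + γ = 3γ`.  Consequently `rank DW(z) ≥ 2`, `dim ker DW(z) ≤ 1`:
for every `ρ > 0` (`γ = 1/(2+ρ) < 1/2`) the vortical stagnation set `{W = 0, Ω ≠ 0}` of a `C²` profile is locally contained in `C²` curves, never in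
surfaces (ROUND-40 §2′). [folklore] -/
theorem exists_fderiv_transport_not_mem_span_of_stagnation (hprof : IsSelfSimilarEulerProfile γ 0 U P) (hγ : γ ≠ 1 / 2)
    {z : (EuclideanSpace ℝ (Fin 3))} (hz : selfSimilarTransport γ 0 U z = 0) (hΩ : curl U z ≠ 0) :
    ∃ v : (EuclideanSpace ℝ (Fin 3)), fderiv ℝ (selfSimilarTransport γ 0 U) z v ∉ ℝ ∙ curl U z := by
  by_contra h
  push Not at h
  have hU : DifferentiableAt ℝ U z := (hprof.contDiff_velocity.differentiable (by norm_num)).differentiableAt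
  have htr := trace_fderiv_selfSimilarTransport (γ := γ) hU (hprof.divFree z)
  have heig := fderiv_transport_apply_curl_of_stagnation hprof hz
  have htr' : LinearMap.trace ℝ (EuclideanSpace ℝ (Fin 3)) ((fderiv ℝ (selfSimilarTransport γ 0 U) z : (EuclideanSpace ℝ (Fin 3)) →L[ℝ] (EuclideanSpace ℝ (Fin 3))) : (EuclideanSpace ℝ (Fin 3)) →ₗ[ℝ] (EuclideanSpace ℝ (Fin 3))) = 1 + γ :=
    trace_eq_of_range_le_span (T := ((fderiv ℝ (selfSimilarTransport γ 0 U) z : (EuclideanSpace ℝ (Fin 3)) →L[ℝ] (EuclideanSpace ℝ (Fin 3))) : (EuclideanSpace ℝ (Fin 3)) →ₗ[ℝ] (EuclideanSpace ℝ (Fin 3)))) hΩ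
      (by simpa using heig) (fun v => by simpa using h v)
  rw [htr] at htr'
  exact hγ (by linarith)

/-- **`dim ker DW(z) ≤ 1` at a vortical stagnation point (`0 < γ`, `γ ≠ 1/2`)**: `Ω(z) = DW((1+γ)⁻¹Ω)` and some `DW v ∉ ℝ ∙ Ω` are two
independent vectors of the range, and rank–nullity in `ℝ³`. -/
theorem finrank_ker_fderiv_transport_le_one_of_stagnation (hprof : IsSelfSimilarEulerProfile γ 0 U P) (hγ0 : 0 < γ)
    (hγ : γ ≠ 1 / 2) {z : (EuclideanSpace ℝ (Fin 3))} (hz : selfSimilarTransport γ 0 U z = 0) (hΩ : curl U z ≠ 0) :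
    Module.finrank ℝ (LinearMap.ker ((fderiv ℝ (selfSimilarTransport γ 0 U) z : (EuclideanSpace ℝ (Fin 3)) →L[ℝ] (EuclideanSpace ℝ (Fin 3))) : (EuclideanSpace ℝ (Fin 3)) →ₗ[ℝ] (EuclideanSpace ℝ (Fin 3)))) ≤ 1 := by
  set T : (EuclideanSpace ℝ (Fin 3)) →ₗ[ℝ] (EuclideanSpace ℝ (Fin 3)) := ((fderiv ℝ (selfSimilarTransport γ 0 U) z : (EuclideanSpace ℝ (Fin 3)) →L[ℝ] (EuclideanSpace ℝ (Fin 3))) : (EuclideanSpace ℝ (Fin 3)) →ₗ[ℝ] (EuclideanSpace ℝ (Fin 3))) with hT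
  obtain ⟨v, hv⟩ := exists_fderiv_transport_not_mem_span_of_stagnation hprof hγ hz hΩ
  have hv' : T v ∉ ℝ ∙ curl U z := by simpa [hT] using hv
  have heig : T (curl U z) = (1 + γ) • curl U z := by
    simpa [hT] using fderiv_transport_apply_curl_of_stagnation hprof hz
  have h1γ : (1 + γ) ≠ 0 := by intro h0; linarith
  -- `Ω` and `T v` are linearly independent
  have hli : LinearIndependent ℝ ![curl U z, T v] := by
    refine LinearIndependent.pair_iff.2 fun s t hst => ?_
    rcases eq_or_ne t 0 with ht | ht
    · rw [ht, zero_smul, add_zero] at hst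
      exact ⟨(smul_eq_zero.1 hst).resolve_right hΩ, ht⟩
    · exfalso
      apply hv'
      rw [Submodule.mem_span_singleton]
      refine ⟨-(s / t), ?_⟩
      have : t • T v = -(s • curl U z) := eq_neg_of_add_eq_zero_right hst
      calc -(s / t) • curl U z = t⁻¹ • (-(s • curl U z)) := by
            rw [smul_neg, smul_smul, neg_smul, div_eq_inv_mul]
        _ = t⁻¹ • (t • T v) := by rw [this]
        _ = T v := by rw [smul_smul, inv_mul_cancel₀ ht, one_smul]
  -- both vectors lie in the range
  have hspan : Submodule.span ℝ (Set.range ![curl U z, T v]) ≤ LinearMap.range T := by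
    rw [Submodule.span_le]
    rintro w ⟨i, rfl⟩
    fin_cases i
    · exact ⟨(1 + γ)⁻¹ • curl U z, by simp [map_smul, heig, smul_smul, inv_mul_cancel₀ h1γ]⟩
    · exact ⟨v, by simp⟩
  have h2 : 2 ≤ Module.finrank ℝ (LinearMap.range T) := by
    have := Submodule.finrank_mono hspan
    rwa [finrank_span_eq_card hli, Fintype.card_fin] at this
  have hrn := LinearMap.finrank_range_add_finrank_ker T
  rw [finrank_euclideanSpace_fin] at hrn
  omega

end Summit.NavierStokesRegularity.NavierStokesRegularity.Theorems.PowerGaugeEulerLiouville.Stagnation
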